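import Mathlib
import Summits.NavierStokesRegularity.NavierStokesRegularity.Theorems.EulerZoomLiouvillePowerGaugeEulerLiouvilleSelfSimilarTopBadNodeHyperbolic
import HarnessLib.Audit

/-!
# Rung C1 of the crux `EulerZoomLiouville.PowerGaugeEulerLiouville`: the Bernoulli landscape along the kernel line of
# the top bad node — derivative where the transport is parallel, and the exact action budget of the kernel coordinate

Route №10 `EulerZoomLiouville` (NavierStokesRegularity), crux E = stmt-NavierStokesRegularity-19832,
tenure rung C1 (exactly self-similar members), registered residue `stub_selfSimilarExtremal`.
Fourteenth file of the NODAL-CONTINUUM line (lineage ns-typeII-p1, gen 7): steps (1a) and (1c) of the top-node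
closure plan (evidence TOPNODE-CLOSURE-PLAN on the crux item), for a `C²` stationary self-similar Euler profile
`(U, P)` (CIV 2026 (3.3); `V = γ(y−c) + U`, `ℋ` the Bernoulli function (3.30)):

* `fderiv_selfSimilarBernoulli_of_transport_parallel` — at a point where the transport is PARALLEL to a unit
  vector `e`, `V(y) = φe`: `Dℋ(y)[w] = φ·((2γ−1)⟪e, w⟫ + ⟪e, DU(y)w⟫ − ⟪DU(y)e, w⟫)` (CIV (3.29)); along the zero
  curve `W` through the top bad node (`V∘W ∥ e`) this is `(ℋ∘W)′ = (2γ−1)φ(1 + o(1))`;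
* `hasDerivAt_kernelCoord` — along a backward trajectory `Y' = −V(Y)` the kernel coordinate
  `σ(t) = ⟪e, Y(t) − z⟫` has `σ′ = −⟪e, V(Y)⟫`;
* `integral_kernelCoord_speed_sq_le` — **EXACT ACTION BUDGET** (`γ < ½`): for `a ≤ b`,
  `(1−2γ) ∫_a^b ⟪e, V(Y t)⟫² dt ≤ ℋ(Y b) − ℋ(Y a)` (from `dℋ(Y)/dt = (1−2γ)|V(Y)|²` and `⟪e,V⟫² ≤ |V|²`): a
  trajectory confined to `{ℋ < ℋ(z♭)}` that starts `ε`-close to `z♭` has total squared kernel speed `O(ε²)`.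

WHAT THIS IS NOT: not NS, not E, not rung C1 — calculus bookkeeping for classical profiles.
References: P. Constantin, M. Ignatova, V. Vicol, arXiv:2602.17570 (2026), §3.4.3 (3.29)–(3.31).
[ConstantinIgnatovaVicol2026Putative]
-/

noncomputable section

-- flat `Theorems/<Route><Decl>…` files of one crux share the namespace of the crux (tree convention)
set_option linter.dupNamespace false

open Set Filter Topology Metric Function InnerProductSpace MeasureTheory
open scoped RealInnerProductSpace NNReal Interval

namespace Summit.NavierStokesRegularity.NavierStokesRegularity.Theorems.PowerGaugeEulerLiouville.NodalContinuum

open Literature.Analysis Literature.Analysis.FluidPDE Literature.Analysis.ODE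
open Summit.NavierStokesRegularity.NavierStokesRegularity.Theorems.PowerGaugeEulerLiouville.NodalFiniteness

variable {γ : ℝ} {c : EuclideanSpace ℝ (Fin 3)}
  {U : EuclideanSpace ℝ (Fin 3) → EuclideanSpace ℝ (Fin 3)} {P : EuclideanSpace ℝ (Fin 3) → ℝ}

/-- **Gradient of `ℋ` where the transport is parallel to `e`.**  If `V(y) = φe` then
`Dℋ(y)[w] = φ((2γ−1)⟪e, w⟫ + ⟪e, DU(y)w⟫ − ⟪DU(y)e, w⟫)`. [cite: ConstantinIgnatovaVicol2026Putative, §3.4.3 eq. (3.29)] -/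
theorem fderiv_selfSimilarBernoulli_of_transport_parallel (h : IsSelfSimilarEulerProfile γ c U P)
    {y e : EuclideanSpace ℝ (Fin 3)} {φ : ℝ} (hV : selfSimilarTransport γ c U y = φ • e)
    (w : EuclideanSpace ℝ (Fin 3)) :
    fderiv ℝ (selfSimilarBernoulli γ c U P) y w =
      φ * ((2 * γ - 1) * ⟪e, w⟫ + (⟪e, fderiv ℝ U y w⟫ - ⟪fderiv ℝ U y e, w⟫)) := by
  rw [h.fderiv_selfSimilarBernoulli_apply y w, hV, map_smul, inner_smul_left, inner_smul_left, inner_smul_left]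
  simp only [conj_trivial]
  ring

/-- **The kernel coordinate along a backward trajectory**: `σ(t) = ⟪e, Y(t) − z⟫` has derivative
`−⟪e, V(Y(t))⟫` when `Y' = −V(Y)`. [cite: ConstantinIgnatovaVicol2026Putative, §3.4 eq. (3.21)] -/
theorem hasDerivAt_kernelCoord {Y : ℝ → EuclideanSpace ℝ (Fin 3)} {t : ℝ}
    (hY : HasDerivAt Y ((-1 : ℝ) • selfSimilarTransport γ c U (Y t)) t) (e z : EuclideanSpace ℝ (Fin 3)) :
    HasDerivAt (fun s => ⟪e, Y s - z⟫) (-⟪e, selfSimilarTransport γ c U (Y t)⟫) t := by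
  have h1 := (hasDerivAt_const t e).inner ℝ (hY.sub_const z)
  refine (h1.congr_deriv ?_)
  rw [inner_zero_left, add_zero, inner_smul_right]
  ring

/-- **Exact action budget of the kernel coordinate** (`γ < ½`): along a backward trajectory `Y' = −V(Y)` and
for `a ≤ b`, `(1−2γ) ∫_a^b ⟪e, V(Y t)⟫² dt ≤ ℋ(Y b) − ℋ(Y a)` for every unit vector `e`
(`ℋ(Y b) − ℋ(Y a) = (1−2γ)∫_a^b |V(Y)|²`, tree `bernoulli_comp_sub_eq`, and `⟪e, V⟫² ≤ |V|²`).
[cite: ConstantinIgnatovaVicol2026Putative, §3.4.3 eq. (3.31)] -/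
theorem integral_kernelCoord_speed_sq_le (h : IsSelfSimilarEulerProfile γ c U P) (hγ2 : γ < 1 / 2)
    {Y : ℝ → EuclideanSpace ℝ (Fin 3)}
    (hY : ∀ t, HasDerivAt Y ((-1 : ℝ) • selfSimilarTransport γ c U (Y t)) t)
    {e : EuclideanSpace ℝ (Fin 3)} (he : ‖e‖ = 1) {a b : ℝ} (hab : a ≤ b) :
    (1 - 2 * γ) * ∫ t in a..b, ⟪e, selfSimilarTransport γ c U (Y t)⟫ ^ 2 ≤
      selfSimilarBernoulli γ c U P (Y b) - selfSimilarBernoulli γ c U P (Y a) := by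
  set V := selfSimilarTransport γ c U with hV
  have hYc : Continuous Y := continuous_iff_continuousAt.2 fun t => (hY t).continuousAt
  have hVc : Continuous V := by
    have e1 : V = fun y => γ • (y - c) + U y := rfl
    rw [e1]
    exact ((continuous_id.sub continuous_const).const_smul γ).add h.contDiff_velocity.continuous
  have hf : Continuous fun t => ⟪e, V (Y t)⟫ ^ 2 := (continuous_const.inner (hVc.comp hYc)).pow 2
  have hg : Continuous fun t => ‖V (Y t)‖ ^ 2 := (hVc.comp hYc).norm.pow 2
  have hmono : ∫ t in a..b, ⟪e, V (Y t)⟫ ^ 2 ≤ ∫ t in a..b, ‖V (Y t)‖ ^ 2 := by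
    refine intervalIntegral.integral_mono_on hab (hf.intervalIntegrable a b) (hg.intervalIntegrable a b) ?_
    intro t _
    have h1 : |⟪e, V (Y t)⟫| ≤ ‖V (Y t)‖ := (abs_real_inner_le_norm _ _).trans (by rw [he, one_mul])
    have h2 := abs_nonneg ⟪e, V (Y t)⟫
    calc ⟪e, V (Y t)⟫ ^ 2 = |⟪e, V (Y t)⟫| ^ 2 := (sq_abs _).symm
      _ ≤ ‖V (Y t)‖ ^ 2 := pow_le_pow_left₀ h2 h1 2
  have e := h.bernoulli_comp_sub_eq hY a b
  have h12 : 0 ≤ 1 - 2 * γ := by linarith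
  have e2 : (-1 : ℝ) * (2 * γ - 1) = 1 - 2 * γ := by ring
  rw [e2] at e
  rw [e]
  exact mul_le_mul_of_nonneg_left hmono h12

/-- **Budget form**: a backward trajectory through `x` that stays in `{ℋ < H}` has
`(1−2γ)∫_0^T ⟪e, V(Y)⟫² ≤ H − ℋ(x)` for all `T ≥ 0`. [cite: ConstantinIgnatovaVicol2026Putative, §3.4.3 eq. (3.31)] -/
theorem integral_kernelCoord_speed_sq_le_of_lt (h : IsSelfSimilarEulerProfile γ c U P) (hγ2 : γ < 1 / 2)
    {Y : ℝ → EuclideanSpace ℝ (Fin 3)}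
    (hY : ∀ t, HasDerivAt Y ((-1 : ℝ) • selfSimilarTransport γ c U (Y t)) t)
    {e : EuclideanSpace ℝ (Fin 3)} (he : ‖e‖ = 1) {H T : ℝ} (hT : 0 ≤ T)
    (hH : selfSimilarBernoulli γ c U P (Y T) < H) :
    (1 - 2 * γ) * ∫ t in (0 : ℝ)..T, ⟪e, selfSimilarTransport γ c U (Y t)⟫ ^ 2 <
      H - selfSimilarBernoulli γ c U P (Y 0) := by
  have := integral_kernelCoord_speed_sq_le h hγ2 hY he hT
  linarith

end Summit.NavierStokesRegularity.NavierStokesRegularity.Theorems.PowerGaugeEulerLiouville.NodalContinuum
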